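import Summits.NavierStokesRegularity.NavierStokesRegularity.Theorems.ScenarioCensusRowF19peakTop

/-!
# Census row F19 family, peak members — part 2/4: the peak-push floor (core, from row F1a BY NAME), the rows
# P-peak / G-peak / G-lab / F1peak EXCLUDED, the residual `TypeIPeakModeration ↔ Row_F1`

Re-homed for the scenario census (typer seat ns-census-typer-1 g6; lead g8 GO 2026-08-28T18:54Z, OPTIONAL (3) «F19 peak members»:
PORT of ns-idea-3 LINE 13 «peak-push» REV 3, `pub/ideators/ns-idea-3/lines/peak-push/line-peak-push.rev3.lean`, sha16
191fe95c2723e21c, 991 l., §1–§7 — REV 4 = REV 3 + §8 «pressure-force rows», NOT ported now; lean check rc 0, 0 sorry; ref g7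
PRE-CHECK ✓ §12.31; critic idea-crit-3 RE-STAMPs 17:19:45Z / 17:22:09Z; lead g7 BOOKINGS 17:28Z: MEMBERS OF RECORD of the F19
family row = G-peak, IG-peak, F1peak — TREE records under ROW POLICY 15:11Z / cen9 (2), no new row, no value change), split for
the 400-line rule into `ScenarioCensusRowF19peakTop` (§1–§3: speed peaks, criteria, rows, the curved moving level, the
first-crossing lemma) → `ScenarioCensusRowF19peakFloor` (§4–§5: the peak-push floor from row F1a BY NAME, rows P/G/G-lab/F1peak,
residual) → `ScenarioCensusRowF19peakDoor` (§6: the integral door, rows I/IG/PG-peak) → `ScenarioCensusRowF19peak` (§7: the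
lattice on classical solutions; census keys).  Lean text VERBATIM in namespace `…Theorems.ScenarioCensus.PeakPush` (the line's
`…Cruxes.ScenarioCensusRowF1.PeakPushLine` re-homed); the three real-variable tools identical to LINE 11's (`deltaStar_pos`,
`kappa_mul_lt_one`, `hasDerivAt_inv_sqrt_sub`) are taken from the tree's F19 port (`ScenarioCensus.QuasiSteadyTop`,
`ScenarioCensusRowF19Top.lean`) instead of being restated; one bib key corrected (`Tao2013Localisation`); the `[folklore]`
tags of the parameterless row `def`s dropped (gate relocation rule); one-line docstrings added to six undocumented auxiliaries.

This part: `peakPushFloor_of_rowF1a : Row_F1a → PeakPushFloor` (the core: F1a's contrapositive with `C = δ + δ'`, the first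
crossing `exists_peak_hit` of part 1), `peakPushFloor_holds` (with the tree's `ScenarioCensus.row_F1a_excluded`), `rowPpeak_holds`,
`rowGpeak_holds`, `rowGlab_of_rowGpeak` / `rowGlab_holds`, `rowF1peak_of_rowPpeak` / `rowF1peak_holds`; `rowF1_of`,
`typeIPeakModeration_iff_rowF1` (display; `Row_F1` stays OPEN).

No census value is asserted here (the lead books the F19 family); NS regularity is NOT proved; `Row_F1` stays open
(≡ `TypeIPeakModeration`); no summit statement is proved by this file.
-/

noncomputable section

set_option linter.dupNamespace false

open MeasureTheory Set Function Filter TopologicalSpace Metric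
open scoped Topology NNReal ENNReal Laplacian RealInnerProductSpace

namespace Summit.NavierStokesRegularity.NavierStokesRegularity.Theorems.ScenarioCensus.PeakPush

open Literature.Analysis Literature.Analysis.FluidPDE
open Summit.NavierStokesRegularity.NavierStokesRegularity.Theorems
open Summit.NavierStokesRegularity.FluidComputer.PalasekTowerClayBridge

variable {ν T : ℝ} {u : ℝ → E3 → E3} {p : ℝ → E3 → ℝ}

/-! ## §4 The peak-push floor (core) and the rows -/

/-- **Core: row F1a ⇒ the peak-push floor.**  In a Clay blow-up, F1a (contrapositive, rate constant
`C = δ + δ⋆`, `κC < 1`) puts the speed above `C√ν/√(T−t₂)` at times `t₂ ↑ T`; with `K >` the sup of `|u|`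
on `[0,t₁]` and `> Λ`, and `δ' = δ + (δ⋆−δ)/4`, the curved moving level from `t₁` is crossed by time `t₂`
once `K√(T−t₂) ≤ (δ⋆−δ)√ν/2`; the first crossing (§3) is a fast speed peak where both floor
inequalities hold with `δ' > δ`. [folklore] -/
theorem peakPushFloor_of_rowF1a (hF1a : ScenarioCensus.Row_F1a) : PeakPushFloor := by
  intro ν T hν hT u p hmx hLH hdec δ Λ t₁ hδ hδlt ht₁T
  have hsol : IsClassicalNSSolutionOn (Ico 0 T) ν 0 u p := hmx.1
  -- an interior starting time `s₁ ∈ (max t₁ 0, T)`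
  set s₁ : ℝ := (max t₁ 0 + T) / 2 with hs₁def
  have hs₁0 : 0 < s₁ := by
    have : 0 ≤ max t₁ 0 := le_max_right _ _
    rw [hs₁def]; linarith
  have hs₁T : s₁ < T := by
    have : max t₁ 0 < T := max_lt ht₁T hT
    rw [hs₁def]; linarith
  have ht₁s₁ : t₁ < s₁ := by
    have h1 : t₁ ≤ max t₁ 0 := le_max_left _ _
    have h2 : max t₁ 0 < T := max_lt ht₁T hT
    rw [hs₁def]; linarith
  -- `K` above the speed on `[0, s₁]` and above `Λ`
  obtain ⟨q, hsolq, hH, -, -⟩ := RungReynoldsOne.stub_taoCover hν hT hsol hLH hdec ⟨hs₁0, hs₁T⟩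
  obtain ⟨M, hM0, hM⟩ := exists_forall_norm_le_of_hasBoundedSobolevNormsOn hsolq hH
  set K : ℝ := M + max Λ 0 + 1 with hKdef
  have hK0 : 0 < K := by
    have : 0 ≤ max Λ 0 := le_max_right _ _
    rw [hKdef]; linarith
  have hKΛ : Λ < K := by
    have : Λ ≤ max Λ 0 := le_max_left _ _
    rw [hKdef]; linarith
  have hbefore : ∀ t ∈ Icc 0 s₁, ∀ x, ‖u t x‖ < K := fun t ht x => by
    have := hM t ht x
    have : 0 ≤ max Λ 0 := le_max_right _ _
    rw [hKdef]; linarith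
  -- constants
  set g : ℝ := 9 - 2 * Real.sqrt 15 - δ with hgdef
  have hg : 0 < g := by rw [hgdef]; linarith
  have hsν : 0 < Real.sqrt ν := Real.sqrt_pos.2 hν
  set δc : ℝ := (δ + g / 4) * Real.sqrt ν with hδcdef
  have hδc : 0 ≤ δc := by rw [hδcdef]; positivity
  have hδδc : δ * Real.sqrt ν < δc := by
    rw [hδcdef]
    have : δ < δ + g / 4 := by linarith
    exact mul_lt_mul_of_pos_right this hsν
  set C : ℝ := δ + 9 - 2 * Real.sqrt 15 with hCdef
  have hC0 : 0 < C := by rw [hCdef]; linarith [QuasiSteadyTop.deltaStar_pos]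
  have hκC : (9 + 2 * Real.sqrt 15) / 42 * C < 1 := by rw [hCdef]; exact QuasiSteadyTop.kappa_mul_lt_one hδlt
  -- F1a, contrapositively: the speed is frequently above `C√ν/√(T−t)`
  have hnot : ¬ (∀ᶠ t in 𝓝[<] T, ∀ x, Real.sqrt (T - t) * ‖u t x‖ ≤ C * Real.sqrt ν) :=
    fun h => hmx.2 (hF1a ν T C hν hT hC0 hκC u p hsol hLH hdec h)
  have hfreq : ∃ᶠ t in 𝓝[<] T, ∃ x, C * Real.sqrt ν < Real.sqrt (T - t) * ‖u t x‖ :=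
    (Filter.not_eventually.1 hnot).mono fun t ht => by
      push Not at ht
      exact ht
  -- the crossing time `t₂`
  set ρ : ℝ := (g * Real.sqrt ν / (2 * K)) ^ 2 with hρdef
  have hρ : 0 < ρ := by rw [hρdef]; positivity
  set s₂ : ℝ := max s₁ (T - ρ) with hs₂def
  have hs₂T : s₂ < T := max_lt hs₁T (by linarith)
  obtain ⟨t₂, ⟨x₂, hx₂⟩, ht₂⟩ := (hfreq.and_eventually (Ioo_mem_nhdsLT hs₂T)).exists
  have hs₁t₂ : s₁ < t₂ := lt_of_le_of_lt (le_max_left _ _) ht₂.1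
  have ht₂T : t₂ < T := ht₂.2
  have hTt : 0 < T - t₂ := sub_pos.2 ht₂T
  have hsq : 0 < Real.sqrt (T - t₂) := Real.sqrt_pos.2 hTt
  have hreach : ∃ x, movingLevel K δc T s₁ t₂ ≤ ‖u t₂ x‖ := by
    refine ⟨x₂, ?_⟩
    rw [movingLevel_of_ge hs₁t₂.le]
    have h4 : Real.sqrt (T - t₂) ≤ g * Real.sqrt ν / (2 * K) := by
      have hTtρ : T - t₂ ≤ ρ := by
        have : T - ρ ≤ t₂ := (le_max_right _ _).trans ht₂.1.le
        linarith
      have hnn : 0 ≤ g * Real.sqrt ν / (2 * K) := by positivity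
      calc Real.sqrt (T - t₂) ≤ Real.sqrt ρ := Real.sqrt_le_sqrt hTtρ
        _ = g * Real.sqrt ν / (2 * K) := by rw [hρdef, Real.sqrt_sq hnn]
    have h5 : K * Real.sqrt (T - t₂) ≤ g * Real.sqrt ν / 2 := by
      have := mul_le_mul_of_nonneg_left h4 hK0.le
      have e : K * (g * Real.sqrt ν / (2 * K)) = g * Real.sqrt ν / 2 := by
        field_simp
      linarith [e ▸ this]
    have h6 : 2 * δc = (2 * δ + g / 2) * Real.sqrt ν := by rw [hδcdef]; ring
    have h7 : C * Real.sqrt ν = (2 * δ + g) * Real.sqrt ν := by rw [hCdef, hgdef]; ring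
    -- `K + 2δc (√(T−t₂))⁻¹ ≤ C√ν (√(T−t₂))⁻¹ < |u(t₂,x₂)|`
    have h8 : K * Real.sqrt (T - t₂) + 2 * δc ≤ C * Real.sqrt ν := by
      rw [h6, h7]; nlinarith [hsν.le]
    have h9 : K + 2 * δc * (Real.sqrt (T - t₂))⁻¹ ≤ C * Real.sqrt ν * (Real.sqrt (T - t₂))⁻¹ := by
      rw [← div_le_div_iff_of_pos_right hsq] at h8
      have e1 : (K * Real.sqrt (T - t₂) + 2 * δc) / Real.sqrt (T - t₂) =
          K + 2 * δc * (Real.sqrt (T - t₂))⁻¹ := by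
        field_simp
      have e2 : C * Real.sqrt ν / Real.sqrt (T - t₂) = C * Real.sqrt ν * (Real.sqrt (T - t₂))⁻¹ := by
        rw [div_eq_mul_inv]
      rw [e1, e2] at h8
      exact h8
    have h10 : C * Real.sqrt ν * (Real.sqrt (T - t₂))⁻¹ < ‖u t₂ x₂‖ := by
      rw [← div_eq_mul_inv, div_lt_iff₀ hsq]
      linarith [hx₂]
    have h11 : 0 ≤ (Real.sqrt (T - s₁))⁻¹ := inv_nonneg.2 (Real.sqrt_nonneg _)
    have h12 : 2 * δc * ((Real.sqrt (T - t₂))⁻¹ - (Real.sqrt (T - s₁))⁻¹) ≤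
        2 * δc * (Real.sqrt (T - t₂))⁻¹ :=
      mul_le_mul_of_nonneg_left (by linarith) (by positivity)
    linarith
  -- the first crossing
  obtain ⟨t₀, ht₀, x₀, hpeak, heq, hpush, hgain⟩ :=
    exists_peak_hit hν hT hsol hLH hdec hK0 hδc hs₁0 hs₁t₂ ht₂T hbefore hreach
  have ht₀T : t₀ < T := ht₀.2.trans_lt ht₂T
  have hKle : K ≤ ‖u t₀ x₀‖ := heq ▸ le_movingLevel hδc ht₀T
  have hupos : 0 < ‖u t₀ x₀‖ := hK0.trans_le hKle
  have hden : 0 < (T - t₀) * Real.sqrt (T - t₀) :=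
    mul_pos (sub_pos.2 ht₀T) (Real.sqrt_pos.2 (sub_pos.2 ht₀T))
  have hstrict : δ * Real.sqrt ν / ((T - t₀) * Real.sqrt (T - t₀)) * ‖u t₀ x₀‖ <
      ‖u t₀ x₀‖ * (δc / ((T - t₀) * Real.sqrt (T - t₀))) := by
    rw [mul_comm (‖u t₀ x₀‖)]
    exact mul_lt_mul_of_pos_right (div_lt_div_of_pos_right hδδc hden) hupos
  refine ⟨t₀, ⟨ht₁s₁.trans ht₀.1, ht₀T⟩, x₀, hpeak, hKΛ.trans_le hKle, ?_, ?_⟩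
  · linarith
  · linarith

/-- **The peak-push floor (kernel).** [folklore] -/
theorem peakPushFloor_holds : PeakPushFloor := peakPushFloor_of_rowF1a ScenarioCensus.row_F1a_excluded

/-- **Row P-peak from the floor** (contrapositive reading). [folklore] -/
theorem rowPpeak_of_peakPushFloor (h : PeakPushFloor) : Row_Ppeak := by
  intro ν T δ hν hT hδ hδlt u p hsol hLH hdec hP
  obtain ⟨Λ, hev⟩ := hP
  obtain ⟨T₀, hT₀T, hT₀⟩ := mem_nhdsLT_iff_exists_Ioo_subset.1 hev
  by_contra hext
  obtain ⟨t, ht, x, hpk, hΛ, hpush, -⟩ := h ν T hν hT u p ⟨hsol, hext⟩ hLH hdec δ Λ T₀ hδ hδlt hT₀T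
  have := hT₀ ht x hpk hΛ
  linarith

/-- **Row G-peak from the floor** (contrapositive reading). [folklore] -/
theorem rowGpeak_of_peakPushFloor (h : PeakPushFloor) : Row_Gpeak := by
  intro ν T δ hν hT hδ hδlt u p hsol hLH hdec hG
  obtain ⟨Λ, hev⟩ := hG
  obtain ⟨T₀, hT₀T, hT₀⟩ := mem_nhdsLT_iff_exists_Ioo_subset.1 hev
  by_contra hext
  obtain ⟨t, ht, x, hpk, hΛ, -, hgain⟩ := h ν T hν hT u p ⟨hsol, hext⟩ hLH hdec δ Λ T₀ hδ hδlt hT₀T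
  have := hT₀ ht x hpk hΛ
  linarith

/-- **Row P-peak EXCLUDED (kernel).** [folklore] -/
theorem rowPpeak_holds : Row_Ppeak := rowPpeak_of_peakPushFloor peakPushFloor_holds

/-- **Row G-peak EXCLUDED (kernel).** [folklore] -/
theorem rowGpeak_holds : Row_Gpeak := rowGpeak_of_peakPushFloor peakPushFloor_holds

/-- Lattice edge: G-peak ⇒ G-lab (a hypothesis at all fast points holds at fast peaks). [folklore] -/
theorem rowGlab_of_rowGpeak (h : Row_Gpeak) : Row_Glab := by
  intro ν T δ hν hT hδ hδlt u p hsol hLH hdec hG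
  obtain ⟨Λ, hev⟩ := hG
  refine h ν T δ hν hT hδ hδlt u p hsol hLH hdec ⟨Λ, ?_⟩
  filter_upwards [hev] with t ht x _ hΛ using ht x hΛ

/-- **Row G-lab EXCLUDED (kernel)** — LINE 12's `Row_Plab` re-derived through the peaks. [folklore] -/
theorem rowGlab_holds : Row_Glab := rowGlab_of_rowGpeak rowGpeak_holds

/-- Type-I member from row P-peak (drop the rate). [folklore] -/
theorem rowF1peak_of_rowPpeak (h : Row_Ppeak) : Row_F1peak :=
  fun ν T δ hν hT hδ hδlt u p hsol hLH hdec _ hP => h ν T δ hν hT hδ hδlt u p hsol hLH hdec hP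

/-- **Row F1peak EXCLUDED (kernel).** [folklore] -/
theorem rowF1peak_holds : Row_F1peak := rowF1peak_of_rowPpeak rowPpeak_holds

/-! ## §5 The residual and the target BY NAME -/

/-- **The split**: Type-I member + residual ⇒ row F1. [folklore] -/
theorem rowF1_of (hD : Row_F1peak) (hR : TypeIPeakModeration) : ScenarioCensus.Row_F1 := by
  unfold ScenarioCensus.Row_F1
  intro ν T hν hT u p hsol hLH hdec hTI
  by_contra hext
  obtain ⟨δ, hδ, hδlt, hP⟩ := hR ν T hν hT u p ⟨hsol, hext⟩ hLH hdec hTI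
  exact hext (hD ν T δ hν hT hδ hδlt u p hsol hLH hdec hTI hP)

/-- The residual is a consequence of the row (vacuously). [folklore] -/
theorem typeIPeakModeration_of_rowF1 (h : ScenarioCensus.Row_F1) : TypeIPeakModeration :=
  fun ν T hν hT u p hmx hLH hdec hTI => (hmx.2 (h ν T hν hT u p hmx.1 hLH hdec hTI)).elim

/-- **The residual is EXACTLY row F1** (declared equivalence, kernel). [folklore] -/
theorem typeIPeakModeration_iff_rowF1 : TypeIPeakModeration ↔ ScenarioCensus.Row_F1 :=
  ⟨fun hR => rowF1_of rowF1peak_holds hR, typeIPeakModeration_of_rowF1⟩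

/-- **Composition concluding the target BY NAME.** [folklore] -/
theorem rowF1_of_typeIPeakModeration : TypeIPeakModeration → ScenarioCensus.Row_F1 :=
  typeIPeakModeration_iff_rowF1.1


end Summit.NavierStokesRegularity.NavierStokesRegularity.Theorems.ScenarioCensus.PeakPush

end
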